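/- Width seat `ym-line-sfw-p2-w5` (prover-ym-line-sfw-p2-w5-g18-0), free hands on planner ym-idea-2 g16's LINE-19 entry kit, item (e)
(crux `AllWindowsColdBox.BoxHighWindowsSU22` = stmt-QuantumFields-24004 / low item 24335): S4 ⇐ S4b, the planner's checked draft
`l26/S4-of-S4b-DRAFT-v11.lean` (sha16 63dd86db64bb877e) as a module over the landed line defs (v11: `LandauBootstrapBound`). -/
import Summits.QuantumFields.YangMills.Theorems.WeakCouplingRatesLargeFieldTail
import Summits.QuantumFields.YangMills.Theorems.WeakCouplingRatesBulkDominatesColdBoxWDatumCompetitor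
import Summits.QuantumFields.YangMills.Theorems.WeakCouplingRatesColdBoxLinkSmall
import Summits.QuantumFields.YangMills.Theorems.WeakCouplingRatesColdBoxLargeFieldSU2
import Summits.QuantumFields.YangMills.Theorems.AllWindowsColdBoxDirProjKernelHodgeForm
import Summits.QuantumFields.YangMills.Theorems.WeakCouplingRates
import Summits.QuantumFields.YangMills.Theorems.WeakCouplingRatesDefs
import Summits.QuantumFields.YangMills.Theorems.AllWindowsColdBoxBoxWindowOfDominationRel
import Literature.MathematicalPhysics.QuantumLattice.LatticeGaugeDLR
import Summits.QuantumFields.YangMills.Theorems.WeakCouplingRatesColdBoxGoodReduction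
import Summits.QuantumFields.YangMills.Theorems.WeakCouplingRatesEventuallyPow
import Literature.MathematicalPhysics.QuantumFieldTheory.LatticeGaugeShenZhuZhuProofs
import HarnessLib
import Summits.QuantumFields.YangMills.Theorems.AllWindowsColdBoxBoxHighWindowsSU22LineDefs

/-!
# LINE-19: stub S4 `stub_gaugeBallReduction` is a COROLLARY of stub S4b (`LandauBootstrapBound`, skeleton v11) — `gaugeBallReduction_of_landauRepresentative`

For LINE-19 «Landau sector: log-concave reduction + relative second order» (registered skeleton v11 `4064e2698b46c8ed`,
`Cruxes/BoxHighWindowsSU22/Lines/landau_sector_relative_bl.lean`; plan `Cruxes/BoxHighWindowsSU22/STUB-PLAN-S4b.md` §9): the gauge-ball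
reduction S4 — «at scale `H = ⌈β^θ⌉`, `θ ≤ θL < 1/12`, the cold-box state gives mass `≤ exp(−β^κ₂)` to configurations NOT interior-gauge-equivalent
to one whose box links all have defect `≤ β^{−1+2κ}`» with `κ = 1/4`, `κ₂ = (1/4 − 3θL)/8` — follows from the small Landau representative S4b
(`LandauBootstrapBound`, v10/v11 typing: premise `s·H⁴(1+log H)² ≤ c₀`, per-link defect `≤ C·H²(1+log H)⁴·s²`) + the landed cold-box LARGE-FIELD
RARITY ✓`WeakCouplingRates.boxState_largeField_rarity` (every `ε > 2θ`) + the DLR properness of the box state (cold wall a.s.):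
`smallPlaquettes_of_coldWall_of_good` (plaquettes not touching the box have all links `1`), `one_add_log_boxSide_le` (`1 + log⌈β^θ⌉ ≤ (3 + 2/g)β^{g/2}`),
and the exponent bookkeeping `ε = 2θ + g`, `s = β^{ε − 1/2}` (radius `6θ + 4g < 1/2`, premise `6θ + 2g < 1/2`, both iff `θL < 1/12`).

Result: **`gaugeBallReduction_of_landauRepresentative : LandauBootstrapBound → ∀ θL < 1/12, ∃ κ, 0 < κ ∧ κ < 1/2 − 3θL ∧ GaugeBallReduction θL κ`**
— so the by-name S4 is ONE line once S4b lands by name.  Lean text: planner ym-idea-2 g16 (checked draft, rc 0 · 0 sorry); this seat made it a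
module (imports the landed line defs instead of a copy; the orientation symmetry of the plaquette cost inlined from two Literature lemmas instead of a
restated tree theorem) and re-checked.  Everything proved; no definition; standard axioms.  HONEST LABEL: an implication between two registered
stubs of a critic-PASSed line on the R2ξ″ RECORD-rung crux 24004 / 24335 — S4b itself is OPEN, so S4 is NOT closed by this file; no crux, rung or
summit is proved; the Yang–Mills mass gap is NOT proved by this file.
-/

set_option autoImplicit false

noncomputable section

open MeasureTheory Matrix
open Literature.MathematicalPhysics.QuantumFieldTheory hiding boxEdges
open Literature.MathematicalPhysics.QuantumFieldTheory.LatticeMaxwell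
open Literature.MathematicalPhysics.QuantumFieldTheory.AxialGauge
open Summit.QuantumFields.YangMills.Theorems.WeakCouplingRates

/-! ## S4 from S4b (planner ym-idea-2 g16): the registered stub S4 `stub_gaugeBallReduction` as a COROLLARY of
S4b `LandauBootstrapBound` + the landed cold-box large-field rarity `WeakCouplingRates.boxState_largeField_rarity`
(every `ε > 2θ`) + the DLR properness of the box state (cold wall a.s.).  Exponents (skeleton v10 typing of S4b: premise
`s·H⁴(1+log H)² ≤ c₀`, conclusion `C·H²(1+log H)⁴·s²`): `κ = 1/4`, `κ₂ = g = (1/4 - 3 θL)/8`, `ε = 2θ + g`, `s = β^(ε - 1/2)`; the two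
eventual inequalities are `6θ + 4g < 1/2` (radius) and `6θ + 2g < 1/2` (S4b premise), both ⇔ `θL < 1/12` exactly; logs are absorbed by
`log β ≤ (2/g) β^(g/2)`. -/

namespace Summit.QuantumFields.YangMills.Theorems.AllWindowsColdBoxBoxHighLine

open Literature.Probability.LatticeModels (Site)
open Literature.MathematicalPhysics.QuantumLattice

/-- The plaquette cost of a plaquette all of whose links are `1` vanishes. -/
theorem plaqCostAt_eq_zero_of_links_one (x : Site 4) (i j : Fin 4) (U : LGConfig 4 SU2)
    (h1 : U (x, i) = 1) (h2 : U (x + Pi.single i 1, j) = 1) (h3 : U (x + Pi.single j 1, i) = 1)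
    (h4 : U (x, j) = 1) : plaqCostAt (fundamentalRep (Fin 2)) x i j U = 0 := by
  unfold plaqCostAt Literature.MathematicalPhysics.QuantumLattice.plaquetteObs plaquetteHolonomyZd
  rw [h1, h2, h3, h4]
  simp [Matrix.trace_one]

/-- On a cold-wall configuration whose plaquettes TOUCHING the box all cost `< s²`, every plaquette costs `≤ s²`
(a plaquette not touching the box has its four links equal to `1`). -/
theorem smallPlaquettes_of_coldWall_of_good {H : ℕ} {s : ℝ} {U : LGConfig 4 SU2} (hcold : ColdWall H U)
    (hgood : ∀ p ∈ plaquettesTouching (boxEdges 4 (2 * H + 1)),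
      plaqCostAt (fundamentalRep (Fin 2)) p.1 p.2.1.1 p.2.1.2 U < s ^ 2) :
    SmallPlaquettes H s U := by
  have key : ∀ (x : Site 4) (i j : Fin 4), i < j → plaqCostAt (fundamentalRep (Fin 2)) x i j U ≤ s ^ 2 := by
    intro x i j hij
    let p : ZdPlaquette 4 := (x, ⟨(i, j), hij⟩)
    by_cases hp : p ∈ plaquettesTouching (boxEdges 4 (2 * H + 1))
    · exact (hgood p hp).le
    · rw [mem_plaquettesTouching_iff, Finset.not_nonempty_iff_eq_empty] at hp
      have hout : ∀ e ∈ plaquetteEdges p, e ∉ boxEdges 4 (2 * H + 1) := by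
        intro e he heΛ
        have : e ∈ plaquetteEdges p ∩ boxEdges 4 (2 * H + 1) := Finset.mem_inter.2 ⟨he, heΛ⟩
        rw [hp] at this
        simp at this
      have hz := plaqCostAt_eq_zero_of_links_one x i j U
        (hcold _ (hout _ (by simp [plaquetteEdges, p]))) (hcold _ (hout _ (by simp [plaquetteEdges, p])))
        (hcold _ (hout _ (by simp [plaquetteEdges, p]))) (hcold _ (hout _ (by simp [plaquetteEdges, p])))
      rw [hz]; positivity
  intro x _ i j hij
  rcases lt_or_gt_of_ne hij with h | h
  · exact key x i j h
  · -- orientation symmetry of the plaquette cost (tree: `…UVSeamRec.ClassicalResponse.ColdWall.plaqCostAt_swap`; inlined to keep the imports light)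
    have hswap : plaqCostAt (fundamentalRep (Fin 2)) x j i U = plaqCostAt (fundamentalRep (Fin 2)) x i j U := by
      have hh : plaquetteHolonomyZd U x j i = (plaquetteHolonomyZd U x i j)⁻¹ := by
        simp only [plaquetteHolonomyZd, _root_.mul_inv_rev, inv_inv, mul_assoc]
      unfold plaqCostAt Literature.MathematicalPhysics.QuantumLattice.plaquetteObs
      rw [hh, Literature.RepresentationTheory.CompactGroups.CompactGroup.re_trace_map_inv _ (continuous_fundamentalRep (Fin 2))]
    rw [← hswap]
    exact key x j i h

/-- Logarithm of the box side absorbed into a small power of `β`: `1 + log ⌈β^θ⌉ ≤ (3 + 2/g) β^(g/2)`. -/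
theorem one_add_log_boxSide_le {β θ g : ℝ} (hβ : 1 ≤ β) (hθ0 : 0 ≤ θ) (hθ1 : θ ≤ 1) (hg : 0 < g) :
    1 + Real.log (⌈β ^ θ⌉₊ : ℝ) ≤ (3 + 2 / g) * β ^ (g / 2) := by
  have hβ0 : 0 < β := by linarith
  obtain ⟨h1, h2⟩ := one_le_ceil_rpow_and_le hβ hθ0
  have hlogH : Real.log (⌈β ^ θ⌉₊ : ℝ) ≤ Real.log 2 + θ * Real.log β := by
    calc Real.log (⌈β ^ θ⌉₊ : ℝ) ≤ Real.log (2 * β ^ θ) := Real.log_le_log (by linarith) h2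
      _ = Real.log 2 + θ * Real.log β := by
          rw [Real.log_mul (by norm_num) (by positivity), Real.log_rpow hβ0]
  have hlog2 : Real.log 2 ≤ 1 := by have := Real.log_two_lt_d9; linarith
  have hlogβ : 0 ≤ Real.log β := Real.log_nonneg hβ
  have hlogβ' : Real.log β ≤ β ^ (g / 2) / (g / 2) := Real.log_le_rpow_div hβ0.le (by positivity)
  have hpow1 : 1 ≤ β ^ (g / 2) := Real.one_le_rpow hβ (by positivity)
  have hθlog : θ * Real.log β ≤ Real.log β := by nlinarith
  have h2g : 0 < 2 / g := by positivity
  calc 1 + Real.log (⌈β ^ θ⌉₊ : ℝ) ≤ 2 + Real.log β := by linarith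
    _ ≤ 2 + β ^ (g / 2) / (g / 2) := by linarith
    _ = 2 + (2 / g) * β ^ (g / 2) := by ring
    _ ≤ (3 + 2 / g) * β ^ (g / 2) := by nlinarith

/-- **S4 from S4b.**  The registered stub S4 `stub_gaugeBallReduction` of LINE-19, as a corollary of S4b
`LandauBootstrapBound` (v10 typing; `κ = 1/4`, `κ₂ = (1/4 - 3θL)/8`). -/
theorem gaugeBallReduction_of_landauRepresentative (h4b : LandauBootstrapBound) :
    ∀ θL : ℝ, θL < 1 / 12 → ∃ κ : ℝ, 0 < κ ∧ κ < 1 / 2 - 3 * θL ∧ GaugeBallReduction θL κ := by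
  intro θL hθL
  refine ⟨1 / 4, by norm_num, by linarith, ?_⟩
  obtain ⟨C, c₀, hC, hc₀, h4⟩ := h4b
  set g : ℝ := (1 / 4 - 3 * θL) / 8 with hg
  have hg0 : 0 < g := by rw [hg]; linarith
  refine ⟨g, hg0, fun θ hθ hθle => ?_⟩
  have hθ12 : θ < 1 / 12 := lt_of_le_of_lt hθle hθL
  set ε : ℝ := 2 * θ + g with hε
  have h2θε : 2 * θ < ε := by rw [hε]; linarith
  have hgε : g ≤ ε := by rw [hε]; linarith
  -- (R) rarity of large fields in the cold box
  obtain ⟨β₁, hrar⟩ := boxState_largeField_rarity hθ h2θε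
  -- (A) the S4b defect fits in the ball
  obtain ⟨β₂, hβ₂1, hA⟩ := exists_const_mul_boxSide_pow_mul_rpow_le (C * (3 + 2 / g) ^ 4) 2
    (θ := θ) (a := 2 * g + (2 * ε - 1)) (b := 2 * (1 / 4 : ℝ) - 1) hθ (by rw [hε, hg]; push_cast; linarith)
  -- (P) the S4b premise
  obtain ⟨β₃, hβ₃1, hP⟩ := exists_const_mul_boxSide_pow_mul_rpow_le ((3 + 2 / g) ^ 2 / c₀) 4
    (θ := θ) (a := (ε - 1 / 2) + g) (b := 0) hθ (by rw [hε, hg]; push_cast; linarith)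
  refine ⟨max (max β₁ β₂) β₃, fun β hβ => ?_⟩
  have hβ1' : β₁ ≤ β := le_trans (le_trans (le_max_left _ _) (le_max_left _ _)) hβ
  have hβ2' : β₂ ≤ β := le_trans (le_trans (le_max_right _ _) (le_max_left _ _)) hβ
  have hβ3' : β₃ ≤ β := le_trans (le_max_right _ _) hβ
  have hβ1 : 1 ≤ β := hβ₂1.trans hβ2'
  have hβ0 : 0 < β := by linarith
  have hlog := one_add_log_boxSide_le (g := g) hβ1 hθ.le (by linarith) hg0
  obtain ⟨hH1, hH2⟩ := one_le_ceil_rpow_and_le hβ1 hθ.le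
  have hrarβ := hrar β hβ1'
  have hAβ := hA β hβ2'
  have hPβ := hP β hβ3'
  clear hrar hA hP
  set H : ℕ := ⌈β ^ θ⌉₊ with hH
  have hHnat : 1 ≤ H := by exact_mod_cast hH1
  have hlog0 : 0 ≤ 1 + Real.log (H : ℝ) := by linarith [Real.log_nonneg hH1]
  have hHle : (H : ℝ) ≤ 2 * (H : ℝ) + 3 := by linarith
  -- the small-plaquette scale `s = β^(ε - 1/2)`
  have hs0 : 0 ≤ β ^ (ε - 1 / 2) := by positivity
  have hs2 : (β ^ (ε - 1 / 2)) ^ 2 = β ^ (2 * ε - 1) := by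
    rw [← Real.rpow_natCast, ← Real.rpow_mul hβ0.le]; congr 1; push_cast; ring
  have hg2 : (β ^ (g / 2)) ^ 2 = β ^ g := by
    rw [← Real.rpow_natCast, ← Real.rpow_mul hβ0.le]; congr 1; push_cast; ring
  have hg4 : (β ^ (g / 2)) ^ 4 = β ^ (2 * g) := by
    rw [← Real.rpow_natCast, ← Real.rpow_mul hβ0.le]; congr 1; push_cast; ring
  have hlogsq : (1 + Real.log (H : ℝ)) ^ 2 ≤ ((3 + 2 / g) * β ^ (g / 2)) ^ 2 := by gcongr
  have hlog4 : (1 + Real.log (H : ℝ)) ^ 4 ≤ ((3 + 2 / g) * β ^ (g / 2)) ^ 4 := by gcongr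
  -- premise of S4b
  have hprem : β ^ (ε - 1 / 2) * (H : ℝ) ^ 4 * (1 + Real.log H) ^ 2 ≤ c₀ := by
    rw [Real.rpow_zero] at hPβ
    have hH4 : (H : ℝ) ^ 4 ≤ (2 * (H : ℝ) + 3) ^ 4 := by gcongr
    have hsplit : β ^ (ε - 1 / 2 + g) = β ^ (ε - 1 / 2) * β ^ g := Real.rpow_add hβ0 _ _
    calc β ^ (ε - 1 / 2) * (H : ℝ) ^ 4 * (1 + Real.log H) ^ 2
        ≤ β ^ (ε - 1 / 2) * (2 * (H : ℝ) + 3) ^ 4 * ((3 + 2 / g) * β ^ (g / 2)) ^ 2 := by gcongr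
      _ = c₀ * ((3 + 2 / g) ^ 2 / c₀ * (2 * (H : ℝ) + 3) ^ 4 * β ^ (ε - 1 / 2 + g)) := by
          rw [hsplit, mul_pow, hg2]; field_simp
      _ ≤ c₀ * 1 := by gcongr
      _ = c₀ := mul_one _
  -- radius: the S4b defect bound fits inside the gauge ball of radius `β^(-1/2 + 1/4)`
  have hrad : C * (H : ℝ) ^ 2 * (1 + Real.log H) ^ 4 * (β ^ (ε - 1 / 2)) ^ 2 ≤ (β ^ (-(1 : ℝ) / 2 + 1 / 4)) ^ 2 := by
    have hH2' : (H : ℝ) ^ 2 ≤ (2 * (H : ℝ) + 3) ^ 2 := by gcongr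
    have hr2 : (β ^ (-(1 : ℝ) / 2 + 1 / 4)) ^ 2 = β ^ (2 * (1 / 4 : ℝ) - 1) := by
      rw [← Real.rpow_natCast, ← Real.rpow_mul hβ0.le]; congr 1; push_cast; ring
    have hsplit : β ^ (2 * g + (2 * ε - 1)) = β ^ (2 * g) * β ^ (2 * ε - 1) := Real.rpow_add hβ0 _ _
    calc C * (H : ℝ) ^ 2 * (1 + Real.log H) ^ 4 * (β ^ (ε - 1 / 2)) ^ 2
        ≤ C * (2 * (H : ℝ) + 3) ^ 2 * ((3 + 2 / g) * β ^ (g / 2)) ^ 4 * (β ^ (ε - 1 / 2)) ^ 2 := by gcongr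
      _ = C * (3 + 2 / g) ^ 4 * (2 * (H : ℝ) + 3) ^ 2 * β ^ (2 * g + (2 * ε - 1)) := by
          rw [hs2, mul_pow, hg4, hsplit]; ring
      _ ≤ β ^ (2 * (1 / 4 : ℝ) - 1) := hAβ
      _ = (β ^ (-(1 : ℝ) / 2 + 1 / 4)) ^ 2 := hr2.symm
  -- pointwise: cold wall ∧ no large field ⇒ in the gauge ball (via S4b)
  have hpt : ∀ U : LGConfig 4 SU2, ColdWall H U → U ∈ coldGoodSet β ε H →
      InGaugeBall H (β ^ (-(1 : ℝ) / 2 + 1 / 4)) U := by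
    intro U hcold hgood
    have hgood' : ∀ p ∈ plaquettesTouching (boxEdges 4 (2 * H + 1)),
        plaqCostAt (fundamentalRep (Fin 2)) p.1 p.2.1.1 p.2.1.2 U < (β ^ (ε - 1 / 2)) ^ 2 := by
      simp only [coldGoodSet, Set.mem_compl_iff, Set.mem_setOf_eq, not_exists, not_and, not_le] at hgood
      intro p hp
      have := hgood p hp
      rw [hs2]; unfold plaqCostAt; push_cast; linarith
    have hsmall : SmallPlaquettes H (β ^ (ε - 1 / 2)) U := smallPlaquettes_of_coldWall_of_good hcold hgood'
    obtain ⟨gT, hgT, -, hdef⟩ := h4 H hHnat _ hs0 hprem U hcold hsmall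
    exact ⟨gT, hgT, fun e he => (hdef e he).trans hrad⟩
  -- measure bound: cold wall a.s. (DLR properness), then monotonicity + rarity
  have hγ : Literature.Probability.LatticeModels.IsSpecification (ymSpecification (d := 4) (fundamentalRep (Fin 2)) β) :=
    isSpecification_ymSpecification_of_t2Space (fundamentalRep (Fin 2)) (continuous_fundamentalRep (Fin 2)) β
  have hae : ∀ᵐ U ∂(boxState (fundamentalRep (Fin 2)) β H), ColdWall H U := by
    have hprop := hγ.proper (boxEdges 4 (2 * H + 1)) (fun _ => 1)
    show ∀ᵐ U ∂(ymSpecification (fundamentalRep (Fin 2)) β (boxEdges 4 (2 * H + 1)) (fun _ => 1)), ColdWall H U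
    filter_upwards [hprop] with U hU
    exact fun e he => hU e he
  have hmono : boxState (fundamentalRep (Fin 2)) β H {U | ¬ InGaugeBall H (β ^ (-(1 : ℝ) / 2 + 1 / 4)) U} ≤
      boxState (fundamentalRep (Fin 2)) β H (coldGoodSet β ε H)ᶜ := by
    refine measure_mono_ae ?_
    filter_upwards [hae] with U hU
    intro hnot
    exact Set.mem_compl fun hgoodc => hnot (hpt U hU hgoodc)
  haveI : IsFiniteMeasure (boxState (fundamentalRep (Fin 2)) β H) := by
    unfold boxState ymSpecification; infer_instance
  have hset : (coldGoodSet β ε H)ᶜ = {U : LGConfig 4 SU2 | ∃ p ∈ plaquettesTouching (boxEdges 4 (2 * H + 1)),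
      β ^ (2 * ε - 1) ≤ (2 : ℝ) - plaquetteObs (fundamentalRep (Fin 2)) p.1 p.2.1.1 p.2.1.2 U} := by
    rw [coldGoodSet, compl_compl]
  calc boxState (fundamentalRep (Fin 2)) β H {U | ¬ InGaugeBall H (β ^ (-(1 : ℝ) / 2 + 1 / 4)) U}
      ≤ boxState (fundamentalRep (Fin 2)) β H (coldGoodSet β ε H)ᶜ := hmono
    _ = ENNReal.ofReal ((boxState (fundamentalRep (Fin 2)) β H).real (coldGoodSet β ε H)ᶜ) :=
        (ENNReal.ofReal_toReal (measure_ne_top _ _)).symm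
    _ ≤ ENNReal.ofReal (Real.exp (-(β ^ ε))) := by
        apply ENNReal.ofReal_le_ofReal
        rw [hset]; exact hrarβ
    _ ≤ ENNReal.ofReal (Real.exp (-(β ^ g))) := by
        apply ENNReal.ofReal_le_ofReal
        apply Real.exp_le_exp.2
        have : β ^ g ≤ β ^ ε := Real.rpow_le_rpow_of_exponent_le hβ1 hgε
        linarith

end Summit.QuantumFields.YangMills.Theorems.AllWindowsColdBoxBoxHighLine

end
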